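import Literature.Computability.FineGrained.CliqueETHGroupingReduction
import Literature.Computability.FineGrained.CliqueETHTMBridge
import HarnessLib

/-!
# `1`-SAT on the word RAM in linear time

Support for the named fact `Literature.Computability.FineGrained.kSATInRAMTime_of_sparseKSATInRAMTime`
(`CliqueETH.lean`; Impagliazzo–Paturi–Zane, JCSS 63 (2001), Cor. 1–2 on the word RAM). Its
proof runs, for `k ≥ 2`, through the Turing-machine sparsification route of the tree, whose
machine-model bridge pads formulas with a clause of width `2`; the widths `k ≤ 1` are settled
here outright: **`KSATInRAMTime 1 δ` for every `δ > 0`** (`OneSat.kSATInRAMTime_one`), by a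
verified linear-time word-RAM program (the width `0` then follows from
`KSATInRAMTime.anti` of `SETHHardnessProofs.lean`).

* `OneSat.Good`: a width-`≤ 1` clause list is satisfiable iff it has no empty clause and no
  complementary pair of unit clauses (`good_iff_satisfiable`), and goodness of a prefix evolves
  clause by clause (`good_append_unit`, `not_good_append_nil`);
* the program `OneSat.prog` (structured word-RAM code `SProg`, verified in `SProg.Achieves`):
  relocate the input `encodeCNFWords φ`, then one pass over the clause blocks keeping a table,
  indexed by literal code `2v + b`, of the unit clauses seen so far — an empty clause sets the
  answer to `0`, a unit clause `[l]` marks its code and clears the answer if the complementary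
  code `litCode l.negate` is marked — and output the answer bit;
* ghost parameters `OneSat.Params` (`x, Lx, X, m, n, T0`, staged data `tabData`, answer `ans`),
  the specs `setup_spec`, `body_spec`, `prog_spec`, the word size `8 (n + inputWidth x)`
  (`fits`), the bound `m ≤ 2 n + 1` for `Nodup` width-`≤ 1` clause lists (`m_le`), and the
  running time `≤ 94 (n + 1)`;
* `kSATProblem_good_iff`: accepted outputs of `kSATProblem k`.

## References

* R. Impagliazzo, R. Paturi, F. Zane, *Which problems have strongly exponential complexity?*,
  JCSS 63 (2001) 512–530, §2, Cor. 1–2.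
* V. Vassilevska Williams, *On some fine-grained questions in algorithms and complexity*,
  Proc. ICM 2018, §2 (the word RAM).
-/

namespace Literature.Computability.FineGrained

open Cryptography Cryptography.WordRAM Complexity Cryptography.WordRAM.SProg

namespace OneSat

/-! ### Literal codes -/

/-- The literal of a code `2 v + b`. [folklore] -/
def decodeLit (c : ℕ) : Literal ℕ := (c / 2, decide (c % 2 = 1))

/-- Decoding a code gives back the literal. [folklore] -/
theorem decodeLit_litCode (l : Literal ℕ) : decodeLit (litCode l) = l := by
  rcases l with ⟨v, b⟩
  unfold decodeLit litCode
  cases b <;> simp [Nat.mul_add_div]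

/-- Coding a decoded literal gives back the code. [folklore] -/
theorem litCode_decodeLit (c : ℕ) : litCode (decodeLit c) = c := by
  unfold decodeLit litCode
  rcases Nat.mod_two_eq_zero_or_one c with h | h <;> simp [h] <;> omega

/-- The code of the negated literal: flip the low bit. [folklore] -/
theorem litCode_negate (l : Literal ℕ) :
    litCode l.negate = litCode l + 1 - 2 * l.2.toNat := by
  rcases l with ⟨v, b⟩
  unfold litCode Literal.negate
  cases b <;> simp

/-- A literal is not its own negation. [folklore] -/
theorem negate_ne (l : Literal ℕ) : l.negate ≠ l := by
  rcases l with ⟨v, b⟩; cases b <;> simp [Literal.negate]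

/-! ### Satisfiability of width-`≤ 1` clause lists -/

/-- A width-`≤ 1` clause list is *good* if it has no empty clause and no complementary pair of
unit clauses. [folklore] -/
def Good (ψ : CNF ℕ) : Prop := [] ∉ ψ ∧ ∀ l : Literal ℕ, [l] ∈ ψ → [l.negate] ∉ ψ

/-- Appending the empty clause destroys goodness. [folklore] -/
theorem not_good_append_nil (ψ : CNF ℕ) : ¬ Good (ψ ++ [[]]) := fun h => h.1 (by simp)

/-- Appending a unit clause keeps goodness iff its complement is absent. [folklore] -/
theorem good_append_unit (ψ : CNF ℕ) (l : Literal ℕ) :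
    Good (ψ ++ [[l]]) ↔ Good ψ ∧ [l.negate] ∉ ψ := by
  constructor
  · rintro ⟨h0, h1⟩
    refine ⟨⟨fun h => h0 (List.mem_append_left _ h), fun l' hl' hn => ?_⟩, fun hn => ?_⟩
    · exact h1 l' (List.mem_append_left _ hl') (List.mem_append_left _ hn)
    · exact h1 l (by simp) (List.mem_append_left _ hn)
  · rintro ⟨⟨h0, h1⟩, hn⟩
    refine ⟨fun h => ?_, fun l' hl' hn' => ?_⟩
    · rw [List.mem_append] at h
      rcases h with h | h
      · exact h0 h
      · simp at h
    · rw [List.mem_append] at hl' hn'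
      simp only [List.mem_singleton, List.cons.injEq, and_true] at hl' hn'
      rcases hl' with hl' | rfl
      · rcases hn' with hn' | hn'
        · exact h1 l' hl' hn'
        · -- `l'.negate = l`, so `l' = l.negate ∈ ψ`
          apply hn
          have : l.negate = l' := by
            rw [← hn']; rcases l' with ⟨v, b⟩; cases b <;> rfl
          rw [this]; exact hl'
      · rcases hn' with hn' | hn'
        · exact hn hn'
        · exact negate_ne _ hn'

/-- **Goodness is satisfiability** for width-`≤ 1` clause lists. [folklore] -/
theorem good_iff_satisfiable {φ : CNF ℕ} (hw : φ.IsWidthLE 1) : Good φ ↔ φ.Satisfiable := by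
  classical
  constructor
  · rintro ⟨h0, h1⟩
    refine ⟨fun v => decide ([((v, true) : Literal ℕ)] ∈ φ), (CNF.eval_eq_true_iff_literal φ _).2 ?_⟩
    intro c hc
    have hlen := hw c hc
    rcases c with _ | ⟨l, c⟩
    · exact absurd hc h0
    · have hc' : c = [] := by
        cases c with
        | nil => rfl
        | cons _ _ => simp at hlen
      subst hc'
      refine ⟨l, by simp, ?_⟩
      rcases l with ⟨v, b⟩
      cases b
      · -- negative literal: `[(v, true)] ∉ φ`
        have : [((v, true) : Literal ℕ)] ∉ φ := by
          have := h1 (v, false) hc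
          simpa [Literal.negate] using this
        simp [this]
      · simp [hc]
  · rintro ⟨σ, hσ⟩
    rw [CNF.eval_eq_true_iff_literal] at hσ
    refine ⟨fun h => ?_, fun l hl hn => ?_⟩
    · obtain ⟨l, hl, -⟩ := hσ [] h; simp at hl
    · obtain ⟨l₁, hl₁, h₁⟩ := hσ _ hl
      obtain ⟨l₂, hl₂, h₂⟩ := hσ _ hn
      simp only [List.mem_singleton] at hl₁ hl₂
      subst hl₁ hl₂
      rcases l₁ with ⟨v, b⟩
      simp only [Literal.negate] at h₂
      rw [h₁] at h₂
      cases b <;> simp at h₂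

/-- Taking one more clause. [folklore] -/
theorem take_succ_eq {α : Type*} (l : List α) {i : ℕ} (hi : i < l.length) :
    l.take (i + 1) = l.take i ++ [l[i]] :=
  List.take_succ_eq_append_getElem hi

/-! ### The program

Register map: `0 = X` (relocated input base), `2 =` remaining clauses, `3 = p` (current block),
`4 = ans`, `5 = T₀` (base of the table of seen unit clauses, indexed by literal code), scratch
`6–10, 20`. -/

/-- Direct operand. [folklore] -/
abbrev r (i : ℕ) : Operand := .dir i
/-- Indirect operand. [folklore] -/
abbrev pt (i : ℕ) : Operand := .ind i
/-- Immediate operand. [folklore] -/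
abbrev im (c : ℕ) : Operand := .imm c

/-- Setup: `r2 := m`, `p := X + 2`, `ans := 1`, `T₀ := X + Lx`. [folklore] -/
def setup : SProg := block [
  (.add, r 20, r 0, im 1), (.band, r 2, pt 20, pt 20), (.add, r 3, r 0, im 2),
  (.band, r 4, im 1, im 1), (.sub, r 5, r 0, im 101), (.add, r 5, r 5, r 0)]

/-- A unit clause: mark its code in the table, test the complementary code, advance `p` by `2`.
[folklore] -/
def unitBlock : SProg := block [
  (.add, r 7, r 3, im 1), (.band, r 7, pt 7, pt 7),
  (.add, r 8, r 5, r 7), (.band, pt 8, im 1, im 1),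
  (.band, r 9, r 7, im 1), (.add, r 9, r 9, r 9), (.add, r 10, r 7, im 1), (.sub, r 9, r 10, r 9),
  (.add, r 9, r 5, r 9), (.band, r 9, pt 9, pt 9),
  (.lt, r 9, r 9, im 1), (.band, r 4, r 4, r 9),
  (.add, r 3, r 3, im 2)]

/-- One clause: empty (answer `0`, advance `p` by `1`) or unit. [folklore] -/
def body : SProg := seqs [
  block [(.band, r 6, pt 3, pt 3)],
  ifz (r 6) (block [(.band, r 4, im 0, im 0), (.add, r 3, r 3, im 1)]) unitBlock,
  block [(.sub, r 2, r 2, im 1)]]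

/-- The read-out: `[ans]`. [folklore] -/
def out : SProg := block [(.band, r 1, r 4, r 4), (.band, r 0, im 1, im 1)]

/-- **The `1`-SAT program.** [folklore] -/
def prog : SProg := seqs [relocate, setup, whilenz (r 2) body, out]

/-- The program is query-free. [folklore] -/
theorem prog_queryFree : prog.QueryFree := by
  simp [prog, setup, body, unitBlock, out, seqs, QueryFree, block_queryFree, relocate_queryFree]

/-! ### Ghost parameters -/

/-- The data of a run: the clause list. [folklore] -/
structure Params where
  /-- The input clause list. -/
  φ : CNF ℕ

namespace Params

open scoped Classical

variable (g : Params)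

/-- The input words. [folklore] -/
def x : List ℕ := encodeCNFWords g.φ
/-- The input length. [folklore] -/
def Lx : ℕ := g.x.length
/-- The base of the relocated input. [folklore] -/
def X : ℕ := g.Lx + 101
/-- The number of clauses. [folklore] -/
def m : ℕ := g.φ.length
/-- The number of variables. [folklore] -/
def n : ℕ := CNF.numVars g.φ
/-- The base of the table. [folklore] -/
def T0 : ℕ := g.X + g.Lx

/-- The data after `i` clauses: the relocated input, and the table of the unit clauses seen so far
(indexed by literal code). [folklore] -/
noncomputable def tabData (i a : ℕ) : ℕ :=
  if a < g.T0 then relocated g.x a else (decide ([decodeLit (a - g.T0)] ∈ g.φ.take i)).toNat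

/-- The answer after `i` clauses. [folklore] -/
noncomputable def ans (i : ℕ) : ℕ := (decide (Good (g.φ.take i))).toNat

/-- Word-size requirements. [folklore] -/
structure Fits (W : ℕ) : Prop where
  top : 2 * g.Lx + 2 * g.n + 104 ≤ 2 ^ W
  width : inputWidth g.x ≤ W

/-- Under `Fits`, the input words fit. [folklore] -/
theorem Fits.input {g : Params} {W : ℕ} (h : g.Fits W) : ∀ v ∈ g.x, v < 2 ^ W := fun v hv =>
  lt_of_lt_of_le (lt_two_pow_inputWidth_of_mem g.x v hv) (Nat.pow_le_pow_right Nat.two_pos h.width)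

/-- `2 ≤ Lx`. [folklore] -/
theorem two_le_Lx : 2 ≤ g.Lx := by
  unfold Lx x; rw [length_encodeCNFWords_eq]; omega

/-- `m + 2 ≤ Lx`. [folklore] -/
theorem m_add_two_le_Lx : g.m + 2 ≤ g.Lx := by
  unfold Lx x m; rw [length_encodeCNFWords_eq, CNF.numClauses]; omega

/-- The linear facts. [folklore] -/
theorem facts {W : ℕ} (hF : g.Fits W) :
    100 < g.X ∧ g.X = g.Lx + 101 ∧ g.T0 = g.X + g.Lx ∧ 2 * g.Lx + 2 * g.n + 104 ≤ 2 ^ W ∧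
      g.m + 2 ≤ g.Lx :=
  ⟨by unfold X; omega, rfl, rfl, hF.top, g.m_add_two_le_Lx⟩

/-- Cell `0` after relocation holds `X`. [folklore] -/
@[simp] theorem relocated_zero' : relocated g.x 0 = g.X := by
  rw [relocated_zero]; rfl

/-- The relocated input. [folklore] -/
theorem relocated_X_add (j : ℕ) : relocated g.x (g.X + j) = g.x.getD j 0 := by
  by_cases hj : j < g.Lx
  · have := relocated_base_add g.x (i := j + 1) (by omega) (by unfold Lx at hj; omega)
    rw [show g.x.length + 100 + (j + 1) = g.X + j by unfold X Lx; omega] at this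
    rw [this]; rfl
  · rw [relocated_of_lt g.x (by unfold X Lx at *; omega),
      List.getD_eq_default _ _ (by unfold Lx at hj; omega)]

/-- Everything from `T0` on is `0` after relocation. [folklore] -/
theorem relocated_of_T0_le {a : ℕ} (ha : g.T0 ≤ a) : relocated g.x a = 0 :=
  relocated_of_lt g.x (by unfold T0 X Lx at ha; omega)

/-- Word `1` of the input is `m`. [folklore] -/
theorem x_getD_one : g.x.getD 1 0 = g.m := by
  unfold x m; rw [List.getD_eq_getElem?_getD, encodeCNFWords_getElem?_one]; rfl

/-- The length word of clause `i`. [folklore] -/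
theorem x_getD_clauseStart {i : ℕ} (hi : i < g.m) :
    g.x.getD (clauseStart g.φ i) 0 = (g.φ[i]'hi).length := by
  unfold x; rw [List.getD_eq_getElem?_getD, encodeCNFWords_getElem?_clauseStart g.φ hi]; rfl

/-- The literal word of a unit clause `i`. [folklore] -/
theorem x_getD_lit {i : ℕ} (hi : i < g.m) {t : ℕ} (ht : t < (g.φ[i]'hi).length) :
    g.x.getD (clauseStart g.φ i + 1 + t) 0 = litCode ((g.φ[i]'hi)[t]'ht) := by
  unfold x; rw [List.getD_eq_getElem?_getD, encodeCNFWords_getElem?_clauseStart_succ g.φ hi ht]; rfl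

/-- Clause blocks lie inside the input. [folklore] -/
theorem clauseStart_le {i : ℕ} (hi : i < g.m) : clauseStart g.φ i + 1 + (g.φ[i]'hi).length ≤ g.Lx :=
  clauseStart_add_length_le g.φ hi

/-- The staged data at an input cell. [folklore] -/
theorem tabData_X_add (i : ℕ) {j : ℕ} (hj : j < g.Lx) : g.tabData i (g.X + j) = g.x.getD j 0 := by
  unfold tabData; rw [if_pos (by unfold T0; omega), relocated_X_add]

/-- Stage `0` is the relocated memory. [folklore] -/
theorem tabData_zero (a : ℕ) : g.tabData 0 a = relocated g.x a := by
  unfold tabData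
  by_cases ha : a < g.T0
  · rw [if_pos ha]
  · rw [if_neg ha, g.relocated_of_T0_le (not_lt.1 ha)]; simp

/-- The empty clause changes nothing in the table. [folklore] -/
theorem tabData_succ_of_nil {i : ℕ} (hi : i < g.m) (h : g.φ[i]'hi = []) (a : ℕ) :
    g.tabData (i + 1) a = g.tabData i a := by
  unfold tabData
  by_cases ha : a < g.T0
  · rw [if_pos ha, if_pos ha]
  · rw [if_neg ha, if_neg ha, take_succ_eq g.φ hi, h]
    simp [List.mem_append]

/-- **A unit clause marked**: writing `1` at `T0 + code` turns stage `i` into stage `i + 1`.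
[folklore] -/
theorem tabData_succ_of_unit {i : ℕ} (hi : i < g.m) {l : Literal ℕ} (h : g.φ[i]'hi = [l])
    {m : ℕ → ℕ} (hm : ∀ a, 100 ≤ a → m a = g.tabData i a) (a : ℕ) (ha : 100 ≤ a) :
    Function.update m (g.T0 + litCode l) 1 a = g.tabData (i + 1) a := by
  have hT0 : g.T0 = g.X + g.Lx := rfl
  by_cases h1 : a = g.T0 + litCode l
  · subst h1
    rw [Function.update_self]
    unfold tabData
    rw [if_neg (by omega), Nat.add_sub_cancel_left, decodeLit_litCode, take_succ_eq g.φ hi, h]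
    simp
  · rw [Function.update_of_ne h1, hm a ha]
    unfold tabData
    by_cases h2 : a < g.T0
    · rw [if_pos h2, if_pos h2]
    · rw [if_neg h2, if_neg h2, take_succ_eq g.φ hi, h]
      have hne : [decodeLit (a - g.T0)] ≠ [l] := by
        intro e
        have e' : decodeLit (a - g.T0) = l := by simpa using e
        apply h1
        have := congrArg litCode e'
        rw [litCode_decodeLit] at this
        omega
      simp [List.mem_append, hne]

/-- The answer after the empty clause is `0`. [folklore] -/
theorem ans_succ_of_nil {i : ℕ} (hi : i < g.m) (h : g.φ[i]'hi = []) : g.ans (i + 1) = 0 := by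
  unfold ans; rw [take_succ_eq g.φ hi, h]; simp [not_good_append_nil]

/-- The answer after a unit clause. [folklore] -/
theorem ans_succ_of_unit {i : ℕ} (hi : i < g.m) {l : Literal ℕ} (h : g.φ[i]'hi = [l]) :
    g.ans (i + 1) = (decide (Good (g.φ.take i)) &&
      !decide ([decodeLit (litCode l.negate)] ∈ g.φ.take i)).toNat := by
  unfold ans
  rw [decodeLit_litCode, take_succ_eq g.φ hi, h]
  congr 1
  apply Bool.eq_iff_iff.2
  simp only [good_append_unit, decide_eq_true_eq, Bool.and_eq_true, Bool.not_eq_true',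
    decide_eq_false_iff_not]

/-- `ans 0 = 1`. [folklore] -/
theorem ans_zero : g.ans 0 = 1 := by
  unfold ans Good; simp

/-- Literal codes are below `2 n`. [folklore] -/
theorem litCode_lt {i : ℕ} (hi : i < g.m) {l : Literal ℕ} (hl : l ∈ g.φ[i]'hi) :
    litCode l < 2 * g.n ∧ litCode l.negate < 2 * g.n := by
  have := CliqueRed.lt_numVars_of_mem (List.getElem_mem hi) hl
  have hb : l.2.toNat ≤ 1 := Bool.toNat_le _
  have hb' : (!l.2).toNat ≤ 1 := Bool.toNat_le _
  unfold n
  refine ⟨?_, ?_⟩ <;> simp only [litCode, Literal.negate] <;> omega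

/-! ### Verification -/

variable {W : ℕ} {O : List ℕ → List ℕ}

/-- The invariant of the clause loop after `i` clauses. [folklore] -/
structure Inv (i : ℕ) (m : ℕ → ℕ) : Prop where
  r0 : m 0 = g.X
  r2 : m 2 = g.m - i
  r3 : m 3 = g.X + clauseStart g.φ i
  r4 : m 4 = g.ans i
  r5 : m 5 = g.T0
  data : ∀ a, 100 ≤ a → m a = g.tabData i a

/-- **Setup.** [folklore] -/
theorem setup_spec (hF : g.Fits W) : Achieves W O setup (relocated g.x) (g.Inv 0) 6 := by
  obtain ⟨hX, hXLx, hT0, htop, hmLx⟩ := g.facts hF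
  have hread : relocated g.x (g.X + 1) = g.m := by rw [relocated_X_add, x_getD_one]
  have e1 : g.X - 101 = g.Lx := by omega
  have e2 : g.Lx + g.X = g.T0 := by omega
  refine CliqueRed.achieves_block_of_eq (fun m' hm' => ?_) le_rfl
  simp (disch := first | omega | decide) only [execOps_cons, execOps_nil, execOp, Operand.write,
    Operand.read, merge_apply_of_lt, merge_apply_of_le, update_merge_of_lt, Function.update_self,
    Function.update_of_ne, BinOp.eval_add_of_lt, BinOp.eval_sub_of_le, BinOp.eval_band,
    Nat.and_self, relocated_zero', hread, e1, e2] at hm'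
  subst hm'
  refine ⟨?_, ?_, ?_, ?_, ?_, fun a ha => ?data⟩
  case data => rw [merge_apply_of_le ha, tabData_zero]
  all_goals (try simp (disch := first | omega | decide) only [merge_apply_of_lt,
    Function.update_self, Function.update_of_ne, relocated_zero', clauseStart_zero, ans_zero])
  all_goals rfl

/-- **One clause.** [folklore] -/
theorem body_spec (hF : g.Fits W) (hw : g.φ.IsWidthLE 1) {i : ℕ} (hi : i < g.m) {m : ℕ → ℕ}
    (h0 : g.Inv i m) : Achieves W O body m (g.Inv (i + 1)) 17 := by
  obtain ⟨hX, hXLx, hT0, htop, hmLx⟩ := g.facts hF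
  obtain ⟨r0, r2, r3, r4, r5, hD⟩ := h0
  have hcs := g.clauseStart_le hi
  have hcs' := clauseStart_succ g.φ hi
  have hlen : (g.φ[i]'hi).length ≤ 1 := hw _ (List.getElem_mem hi)
  have hreadi : m (g.X + clauseStart g.φ i) = (g.φ[i]'hi).length := by
    rw [hD _ (by omega), g.tabData_X_add _ (by omega), g.x_getD_clauseStart hi]
  unfold body
  refine Achieves.mono (T := 1 + ((13 + 2) + (1 + 0))) ?_ (fun _ h => h) (by omega)
  -- read the length
  refine Achieves.seqs_cons (R := fun m₁ => m₁ 6 = (g.φ[i]'hi).length ∧ ∀ a, a ≠ 6 → m₁ a = m a)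
    (T₁ := 1) ?_ ?_
  · refine CliqueRed.achieves_block_of_eq (fun m' hm' => ?_) le_rfl
    simp (disch := first | omega | decide) only [execOps_cons, execOps_nil, execOp, Operand.write,
      Operand.read, merge_apply_of_lt, merge_apply_of_le, update_merge_of_lt, BinOp.eval_band,
      Nat.and_self, r3, hreadi] at hm'
    subst hm'
    refine ⟨by simp [merge_apply_of_lt], fun a ha => ?_⟩
    by_cases h100 : a < 100
    · rw [merge_apply_of_lt h100, Function.update_of_ne ha]
    · rw [merge_apply_of_le (by omega)]
  rintro m₁ ⟨q6, qf⟩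
  have q0 : m₁ 0 = g.X := (qf 0 (by omega)).trans r0
  have q2 : m₁ 2 = g.m - i := (qf 2 (by omega)).trans r2
  have q3 : m₁ 3 = g.X + clauseStart g.φ i := (qf 3 (by omega)).trans r3
  have q4 : m₁ 4 = g.ans i := (qf 4 (by omega)).trans r4
  have q5 : m₁ 5 = g.T0 := (qf 5 (by omega)).trans r5
  have qD : ∀ a, 100 ≤ a → m₁ a = g.tabData i a := fun a ha => (qf a (by omega)).trans (hD a ha)
  -- empty or unit
  refine Achieves.seqs_cons (R := fun m₂ => m₂ 0 = g.X ∧ m₂ 2 = g.m - i ∧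
      m₂ 3 = g.X + clauseStart g.φ (i + 1) ∧ m₂ 4 = g.ans (i + 1) ∧ m₂ 5 = g.T0 ∧
      ∀ a, 100 ≤ a → m₂ a = g.tabData (i + 1) a) (T₁ := 13 + 2) ?_ ?_
  · refine Achieves.ifz (fun hz => ?_) (fun hnz => ?_)
    · -- the empty clause
      simp only [Operand.read, q6] at hz
      have hnil : g.φ[i]'hi = [] := List.eq_nil_of_length_eq_zero hz
      refine Achieves.mono (T := 2) ?_ (fun _ h => h) (by omega)
      refine CliqueRed.achieves_block_of_eq (fun m' hm' => ?_) le_rfl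
      simp (disch := first | omega | decide) only [execOps_cons, execOps_nil, execOp,
        Operand.write, Operand.read, merge_apply_of_lt, update_merge_of_lt,
        Function.update_of_ne, BinOp.eval_add_of_lt, BinOp.eval_band, Nat.and_self, q3] at hm'
      subst hm'
      rw [hnil, List.length_nil] at hcs'
      have ha1 := g.ans_succ_of_nil hi hnil
      refine ⟨?_, ?_, ?_, ?_, ?_, fun a ha => ?data⟩
      case data => rw [merge_apply_of_le ha, qD a ha, g.tabData_succ_of_nil hi hnil]
      all_goals (try simp (disch := first | omega | decide) only [merge_apply_of_lt,
        Function.update_self, Function.update_of_ne])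
      all_goals first | assumption | omega
    · -- a unit clause
      simp only [Operand.read, q6] at hnz
      obtain ⟨l, hl⟩ : ∃ l, g.φ[i]'hi = [l] := by
        rcases h : g.φ[i]'hi with _ | ⟨l, c⟩
        · rw [h] at hnz; exact absurd rfl hnz
        · rw [h] at hlen
          cases c with
          | nil => exact ⟨l, rfl⟩
          | cons _ _ => simp at hlen
      have hl0 : (g.φ[i]'hi)[0]'(by rw [hl]; simp) = l := by simp [hl]
      have hread1 : m₁ (g.X + clauseStart g.φ i + 1) = litCode l := by
        rw [qD _ (by omega), show g.X + clauseStart g.φ i + 1 = g.X + (clauseStart g.φ i + 1 + 0)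
          by omega, g.tabData_X_add _ (by rw [hl] at hcs; simp at hcs; omega),
          g.x_getD_lit hi (by rw [hl]; simp), hl0]
      obtain ⟨hcode, hcode'⟩ := g.litCode_lt hi (l := l) (by rw [hl]; simp)
      have hbit : litCode l &&& 1 = l.2.toNat := CliqueRed.litCode_and_one l
      have hb1 : l.2.toNat ≤ 1 := Bool.toNat_le _
      have hneg : litCode l + 1 - (l.2.toNat + l.2.toNat) = litCode l.negate := by
        rw [litCode_negate]; omega
      have hsub : l.2.toNat + l.2.toNat ≤ litCode l + 1 := by
        unfold litCode; omega
      -- the table read after the mark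
      have hD' : ∀ a, 100 ≤ a → Function.update m₁ (g.T0 + litCode l) 1 a = g.tabData (i + 1) a :=
        g.tabData_succ_of_unit hi hl qD
      have hread2 : m₁ (g.T0 + litCode l.negate) =
          (decide ([decodeLit (litCode l.negate)] ∈ g.φ.take i)).toNat := by
        rw [qD _ (by omega)]; unfold tabData; rw [if_neg (by omega), Nat.add_sub_cancel_left]
      refine CliqueRed.achieves_block_of_eq (fun m' hm' => ?_) le_rfl
      simp (disch := first | assumption | omega | decide) only [execOps_cons, execOps_nil, execOp,
        Operand.write, Operand.read, merge_apply_of_lt, merge_apply_of_le, update_merge_of_lt,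
        update_merge_of_le, Function.update_self, Function.update_of_ne, BinOp.eval_add_of_lt,
        BinOp.eval_sub_of_le, BinOp.eval_band, BinOp.eval_lt, Nat.and_self, q3, q4, q5, hread1,
        hbit, hneg] at hm'
      subst hm'
      rw [hl, List.length_singleton] at hcs'
      have ha1 := g.ans_succ_of_unit hi hl
      refine ⟨?_, ?_, ?_, ?r4, ?_, fun a ha => ?data⟩
      case data => rw [merge_apply_of_le ha]; exact hD' a ha
      case r4 =>
        simp (disch := first | omega | decide) only [merge_apply_of_lt, Function.update_self,
          Function.update_of_ne]
        rw [hread2, ha1, CliqueRed.ite_toNat_lt_one]; unfold ans; rw [CliqueRed.toNat_and_toNat]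
      all_goals (try simp (disch := first | omega | decide) only [merge_apply_of_lt,
        Function.update_self, Function.update_of_ne])
      all_goals first | assumption | omega
  rintro m₂ ⟨s0, s2, s3, s4, s5, sD⟩
  -- count down
  refine Achieves.seqs_cons (T₁ := 1) (T₂ := 0) ?_ (fun _ h => Achieves.seqs_nil h)
  refine CliqueRed.achieves_block_of_eq (fun m' hm' => ?_) le_rfl
  simp (disch := first | omega | decide) only [execOps_cons, execOps_nil, execOp, Operand.write,
    Operand.read, merge_apply_of_lt, update_merge_of_lt, BinOp.eval_sub_of_le, s2] at hm'
  subst hm'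
  refine ⟨?_, ?_, ?_, ?_, ?_, fun a ha => ?data⟩
  case data => rw [merge_apply_of_le ha]; exact sD a ha
  all_goals (try simp (disch := first | omega | decide) only [merge_apply_of_lt,
    Function.update_self, Function.update_of_ne])
  all_goals first | assumption | omega

/-- The final memory: registers `0, 1` hold `1, ans m`. [folklore] -/
structure Final (m : ℕ → ℕ) : Prop where
  r0 : m 0 = 1
  r1 : m 1 = g.ans g.m

/-- **The whole program.** [folklore] -/
theorem prog_spec (hF : g.Fits W) (hw : g.φ.IsWidthLE 1) :
    Achieves W O prog (initFun g.x) g.Final (7 * g.Lx + 6 + (g.m * 19 + 1) + 2) := by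
  obtain ⟨hX, hXLx, hT0, htop, hmLx⟩ := g.facts hF
  unfold prog
  refine Achieves.mono (T := 7 * g.Lx + (6 + ((g.m * (17 + 2) + 1) + (2 + 0)))) ?_ (fun _ h => h)
    (by omega)
  refine Achieves.seqs_cons (R := fun m => m = relocated g.x) (T₁ := 7 * g.Lx)
    (fun qs => ⟨relocated g.x, 7 * g.Lx, le_rfl, ?_, rfl⟩) ?_
  · have h2 := g.two_le_Lx
    unfold Lx at h2 htop
    exact relocate_exec (by omega) hF.input (by omega) qs
  rintro m rfl
  refine Achieves.seqs_cons (g.setup_spec hF) fun m₁ h₁ => ?_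
  refine Achieves.seqs_cons (R := g.Inv g.m) (T₁ := g.m * (17 + 2) + 1)
    (Achieves.whilenz g.m 17 (fun i => g.Inv i) (fun i hi m' hI => ⟨?_, g.body_spec hF hw hi hI⟩)
      (fun m' hI => ?_) h₁ (fun _ h => h) le_rfl) ?_
  · simp only [Operand.read, hI.r2]; omega
  · simp only [Operand.read, hI.r2]; omega
  rintro m₂ ⟨s0, s2, s3, s4, s5, sD⟩
  refine Achieves.seqs_cons (T₁ := 2) (T₂ := 0) ?_ (fun _ h => Achieves.seqs_nil h)
  refine CliqueRed.achieves_block_of_eq (fun m' hm' => ?_) le_rfl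
  simp (disch := first | omega | decide) only [execOps_cons, execOps_nil, execOp, Operand.write,
    Operand.read, merge_apply_of_lt, update_merge_of_lt, BinOp.eval_band, Nat.and_self, s4] at hm'
  subst hm'
  refine ⟨?_, ?_⟩
  all_goals simp (disch := first | omega | decide) only [merge_apply_of_lt,
    Function.update_self, Function.update_of_ne]

/-- The read-out of a final memory. [folklore] -/
theorem readOut_final {m : ℕ → ℕ} (h : g.Final m) : readOut m = [g.ans g.m] := by
  simp [readOut, readSeg, h.r0, h.r1]

/-! ### Word size and time -/

/-- `2 ≤ inputWidth x`. [folklore] -/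
theorem two_le_inputWidth : 2 ≤ inputWidth g.x := by
  have h := g.two_le_Lx
  unfold inputWidth Lx at *
  calc 2 = Nat.size 2 := by decide
    _ ≤ Nat.size (max g.x.length (g.x.foldr max 1)) := Nat.size_le_size (le_max_of_le_left h)

/-- **The word size fits** at `W = 8 (n + inputWidth x)`. [folklore] -/
theorem fits : g.Fits (8 * (g.n + inputWidth g.x)) := by
  set w := inputWidth g.x with hw
  have hw2 : 2 ≤ w := g.two_le_inputWidth
  have hLx : g.Lx < 2 ^ w := length_lt_two_pow_inputWidth _
  have hn : g.n < 2 ^ w := by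
    have h0 : g.x.getD 0 0 = g.n := by
      unfold x n; rw [List.getD_eq_getElem?_getD, encodeCNFWords_getElem?_zero]; rfl
    rw [← h0, List.getD_eq_getElem _ _ (by have := g.two_le_Lx; unfold Lx at this; omega)]
    exact lt_two_pow_inputWidth_of_mem _ _ (List.getElem_mem _)
  have hW : w + 14 ≤ 8 * (g.n + w) := by omega
  have h2 : 2 ^ (w + 14) ≤ 2 ^ (8 * (g.n + w)) := Nat.pow_le_pow_right Nat.two_pos hW
  have h3 : 2 ^ (w + 14) = 2 ^ w * 16384 := by rw [pow_add]; norm_num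
  refine ⟨?_, by omega⟩
  have : 4 * 2 ^ w + 104 ≤ 2 ^ w * 16384 := by have := Nat.one_le_two_pow (n := w); omega
  omega

/-- A width-`≤ 1` clause list without repetitions has at most `2 n + 1` clauses. [folklore] -/
theorem m_le (hw : g.φ.IsWidthLE 1) (hnd : g.φ.Nodup) : g.m ≤ 2 * g.n + 1 := by
  classical
  set L : CNF ℕ := [] :: (List.range g.n).flatMap fun v => [[(v, true)], [(v, false)]] with hL
  have hlen : L.length = 2 * g.n + 1 := by
    rw [hL, List.length_cons, List.length_flatMap]
    simp only [List.length_cons, List.length_nil]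
    rw [List.map_const', List.sum_replicate, List.length_range]; ring
  have hsub : g.φ ⊆ L := by
    intro c hc
    have hl := hw c hc
    rw [hL, List.mem_cons]
    rcases c with _ | ⟨l, c⟩
    · exact Or.inl rfl
    · have hc' : c = [] := by
        cases c with
        | nil => rfl
        | cons _ _ => simp at hl
      subst hc'
      right
      rw [List.mem_flatMap]
      have hv : l.1 < g.n := CliqueRed.lt_numVars_of_mem hc (by simp)
      refine ⟨l.1, List.mem_range.2 hv, ?_⟩
      rcases l with ⟨v, b⟩; cases b <;> simp
  have := (List.subperm_of_subset hnd hsub).length_le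
  unfold m; rw [hlen] at this; exact this

/-- `Lx ≤ 2 + 4 m` for width `≤ 1` (crudely, through the width-`3` bound). [folklore] -/
theorem Lx_le (hw : g.φ.IsWidthLE 1) : g.Lx ≤ 2 + 4 * g.m := by
  have := CliqueRed.size_le_three_mul (hw.mono (by norm_num : 1 ≤ 3))
  unfold Lx x m at *; rw [length_encodeCNFWords_eq, CNF.numClauses]; omega


end Params

end OneSat

open scoped Classical in
/-- Accepted outputs of `kSATProblem k`: `[1]` iff satisfiable (classical `if`). [folklore] -/
theorem kSATProblem_good_iff {k : ℕ} (φ : (kSATProblem k).Inst) (out : List ℕ) :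
    out ∈ (kSATProblem k).Good φ ↔ out = [if φ.1.Satisfiable then 1 else 0] := by
  change out ∈ CNFSAT.Good φ.1 ↔ _
  rw [CNFSAT_good_iff]

namespace OneSat

/-- **`1`-SAT is in word-RAM time `O(2^{δ n})` for every `δ > 0`** (indeed in linear time): the
program `prog` — relocate the input, one pass over the clauses marking unit clauses in a table
indexed by literal code and testing the complementary code, answer `0` on an empty clause or a
complementary pair — at word size `8 (n + inputWidth x)`, within `94 (n + 1)` steps (a `Nodup`
width-`≤ 1` clause list on `n` variables has at most `2 n + 1` clauses). [folklore] -/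
theorem kSATInRAMTime_one (δ : ℝ) (hδ : 0 < δ) : KSATInRAMTime 1 δ := by
  classical
  obtain ⟨C₁, hC₁, hpoly⟩ := exists_pow_le_two_rpow 1 hδ
  refine ⟨prog.toProgram, 8, 100 * C₁, toProgram_isDeterministic _,
    toProgram_isOracleFree prog_queryFree, fun φ => ?_⟩
  obtain ⟨hw, hnd⟩ := φ.2
  set g : Params := ⟨φ.1⟩ with hg
  have hF : g.Fits (8 * (g.n + inputWidth g.x)) := g.fits
  obtain ⟨st, t, ht, hexec, hfin, -⟩ := (g.prog_spec (O := noOracle) hF hw).exists_exec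
  have hexec' : Exec (8 * (g.n + inputWidth g.x)) noOracle prog ⟨(init (8 * (g.n + inputWidth g.x)) g.x).mem, []⟩
      st t := by
    rw [init_mem_eq_initFun hF.width]; exact hexec
  have hout := outputsWithin_toProgram hexec' (le_refl (t + 1)) zeroCoins
  rw [g.readOut_final hfin] at hout
  have hans : g.ans g.m = (if CNF.Satisfiable φ.1 then 1 else 0) := by
    have htake : g.φ.take g.m = φ.1 := List.take_length
    unfold Params.ans
    rw [htake]
    by_cases hs : CNF.Satisfiable φ.1
    · rw [if_pos hs, decide_eq_true ((good_iff_satisfiable hw).2 hs)]; rfl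
    · rw [if_neg hs, decide_eq_false (mt (good_iff_satisfiable hw).1 hs)]; rfl
  rw [hans] at hout
  refine ⟨_, (kSATProblem_good_iff φ _).2 rfl, hout.mono (Nat.le_floor ?_)⟩
  -- the time bound
  show (((t + 1 : ℕ)) : ℝ) ≤ 100 * C₁ * (2 : ℝ) ^ (δ * (g.n : ℝ)) + 100 * C₁
  have hm := g.m_le hw hnd
  have hLx := g.Lx_le hw
  have ht' : t + 1 ≤ 94 * (g.n + 1) := by omega
  have h1 : ((t + 1 : ℕ) : ℝ) ≤ 94 * ((g.n : ℝ) + 1) := by exact_mod_cast ht'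
  have h2 : ((g.n : ℝ) + 1) ≤ C₁ * (2 : ℝ) ^ (δ * (g.n : ℝ)) := by simpa using hpoly g.n
  have h3 : (0 : ℝ) ≤ C₁ * (2 : ℝ) ^ (δ * (g.n : ℝ)) := by positivity
  nlinarith [h1, h2, h3, hC₁]

end OneSat

end Literature.Computability.FineGrained
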